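import Summits.Ventures.CertifiedManyBodySolver.Rows.CorrWindowCertKernelChainQuotAdjCloser
import Summits.Ventures.CertifiedManyBodySolver.Rows.CorrWindowCertKernelEomLocality
import HarnessLib

/-!
# THE CLOSER OF RECORD for u′ certificates: hinted quotient + adjoint chain (`stepEQA`) over the residual sliced with EOM-NEAR slices
# (`residTGslicesNear`, `Rows/CorrWindowCertKernelEomLocality.lean`)

HONEST FRAMING: Lean plumbing towards «tier P»: `affineOrbitLowerRowN_of_quotAdjChainKernelCertTBNear` = the data of
`affineOrbitLowerRowN_of_quotAdjChainKernelCertTB` (`Rows/CorrWindowCertKernelChainQuotAdjCloser.lean`) + per-generator MASKS selecting the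
near Hamiltonian terms + the decidable far check `hfar : eomFarOK TH D.f EB masks = true`; the chain runs over
`groupSlices (residTGslicesNear …) ns` (each eom slice multiplies only the near terms), and `termOp_flatten_residTGslicesNear` puts the full
`[H_{Λ'}, Γ B_k]` back in the identity. Everything else (symmetry family from accepted hints, adjoint generators, ONE inequality) as in the
companion. Nothing of record moves; no claim node is discharged; CONTROL/CALIBRATION context (wording (xx1)); silent on the presence of
superconductivity; not a `T_c` or phase sentence; nothing about any material; no summit statement is proved by this file. Seat hubbard-obs-p2
(STIFFNESS), `prover-hubbard-obs-p2-g23-0`, zero compute.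

References: X. Han, arXiv:2006.06002 §3 [Han2020Bootstrap]; J. Wang et al., PRX 14 (2024) 031006 §III [WangEtAl2024]; C. Jansson,
D. Chaykin, C. Keil, SIAM J. Numer. Anal. 46 (2008) 180 [JanssonChaykinKeil2008]; O. Bratteli, D. W. Robinson, *Operator Algebras and
Quantum Statistical Mechanics 2* §5.2.2 [BratteliRobinsonII1997].
-/

namespace Summit.Ventures.CertifiedManyBodySolver

namespace CARPolyWindow

open Summit.Ventures.CertifiedQuantumChemistry Summit.Ventures.CertifiedQuantumChemistry.CARPoly
open Literature.MathematicalPhysics.QuantumLattice Literature.MathematicalPhysics.QuantumLattice.HubbardWave0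
open Literature.MathematicalPhysics.QuantumManyBody.StateRelaxation
open Literature.Probability.LatticeModels ThermodynamicLimit Filter Topology
open Matrix
open scoped ComplexOrder BigOperators

/-! ## The closer -/

noncomputable section QuotAdjNearCloser

variable {N Nβ : ℕ} [NeZero N]

/-- **THE CLOSER OF RECORD, ABSTRACT GRAM SLICES: hinted-quotient + adjoint `stepEQA` chain over the residual with EOM-NEAR slices (masks +
far check) and ANY Gram slice list `TGs` denoting a `gramForm Λ O` with `Λ ⪰ 0`, empty start, table facts, ONE inequality ⇒
`SquareTTPrimeCorrAffineOrbitLowerRowN tp U q hi lo κhi κlo s n₀ S Λ' (termOp d TX)`.**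
[cite: WangEtAl2024, §III] [cite: Han2020Bootstrap, §3] [cite: JanssonChaykinKeil2008, §3] [cite: BratteliRobinsonII1997, §5.2.2] -/
theorem affineOrbitLowerRowN_of_quotAdjChainKernelCertGNear
    (tp U : ℚ) (hU : 0 ≤ U)
    {Λ Λ' : Finset (Site 2)} (hΛ : Λ ⊆ Λ') (h8 : thicken Λ 1 ⊆ Λ')
    (h0 : thicken ({0} : Finset (Site 2)) 1 ⊆ Λ') (hz : (0 : Site 2) ∈ Λ')
    {S : Finset (DihedralGroup 4)} (h1 : (1 : DihedralGroup 4) ∈ S) (hmul : ∀ a ∈ S, ∀ b ∈ S, a * b ∈ S)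
    -- tables and letters
    (D : QuotData N Nβ) (hxs : ∀ i, D.xs i ∈ Λ') (hix : ∀ y ∈ Λ', D.xs (D.ix y) = y)
    (hxsβ : ∀ j, D.xsβ j ∈ Λ) (hcovβ : ∀ x ∈ Λ, ∃ j, D.xsβ j = x)
    (d : Orb (Fin N) → Orb (PolySite Λ')) (hd : Function.Injective d)
    (hdx : ∀ i σ, d (orb i σ) = orb (PolySite.pt (D.xs i) (hxs i)) σ) (Bkey : ℕ)
    (dΛ : Orb (Fin Nβ) → Orb (PolySite Λ)) (hdΛ : ∀ j σ, dΛ (orb j σ) = orb (PolySite.pt (D.xsβ j) (hxsβ j)) σ)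
    (hf : ∀ b, d (D.f b) = Orb.embMap (PolySite.incl hΛ) (dΛ b))
    (sp : Orb (Fin N) → Fin 2) (hsp : ∀ a, (ofLex (d a)).2 = sp a)
    -- licensed moves: every `ok` code is in `S`, every `ok` move keeps the inner window inside the outer one (table form)
    (hokS : ∀ γc v, D.ok γc v = true → d4OfCode γc ∈ S)
    (hokV : ∀ γc v, D.ok γc v = true →
      ∀ j : Fin Nβ, D.xs (D.ix (d4Vec (d4OfCode γc) (D.xsβ j) + siteOfPair v)) = d4Vec (d4OfCode γc) (D.xsβ j) + siteOfPair v)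
    -- dictionaries
    (TH : Terms (Orb (Fin N))) (hH : termOp d TH = (hubbardTTPrimeFermionInteraction 1 tp U).localHamiltonian Λ')
    (TE : Terms (Orb (Fin N)))
    (hE : termOp d TE = fermionEmbed (PolySite.incl h0) ((hubbardTTPrimeFermionInteraction 1 tp U).meanEnergyObs 1))
    (o : Fin 2 → Orb (Fin N)) (ho : ∀ σ, d (o σ) = orb (PolySite.pt 0 hz) σ)
    -- certificate data (no symmetry family: it rides as hints)
    (TX : Terms (Orb (Fin N))) (μ : Fin 2 → ℚ) (ν κhi hi κlo lo : ℚ)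
    (TGs : List (Terms (Orb (Fin N)))) {m : Type*} [Fintype m] [DecidableEq m] {Λm : Matrix m m ℂ} (hΛm : Λm.PosSemidef)
    (O : m → FermionOp Λ') (hTG : termOp d TGs.flatten = gramForm Λm O) (EB : List (Terms (Orb (Fin Nβ))))
    -- eom locality: per-generator masks of NEAR Hamiltonian terms + the decidable far check
    (masks : List (List Bool)) (hfar : eomFarOK TH D.f EB masks = true)
    (CW : Terms (Orb (Fin N))) (hcw : ∀ wc ∈ CW, chargeW wc.1 ≠ 0 ∨ spinChargeW sp wc.1 ≠ 0)
    (AV : List (Terms (Orb (Fin N))))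
    -- the hinted chain
    (ns : List ℕ) (M : ℕ) (Cs : List SOSDual.EncPoly) (hC0 : Cs.getD 0 [] = []) (Hs : List (List (QHint Nβ)))
    (hchain : ChainQAOK D Bkey M Cs
      (groupSlices (residTGslicesNear TX μ ν o κhi hi κlo lo TE TGs TH D.f EB masks
        (fun l : Fin 0 => l.elim0) (fun l : Fin 0 => l.elim0) CW AV) ns) Hs)
    -- the ONE rational inequality on the last accumulator
    {q s n₀ : ℚ} (hs : s = (μ 0 + μ 1) / 2)
    (hq : q ≤ lowerConst (SOSDual.decPoly N (Cs.getD M [])) + (μ 0 + μ 1) * (n₀ / 2 - ν)) :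
    SquareTTPrimeCorrAffineOrbitLowerRowN (tp : ℝ) (U : ℝ) q hi lo κhi κlo s n₀ S Λ' (termOp d TX) := by
  -- the accepted move family
  set Ts := groupSlices (residTGslicesNear TX μ ν o κhi hi κlo lo TE TGs TH D.f EB masks
    (fun l : Fin 0 => l.elim0) (fun l : Fin 0 => l.elim0) CW AV) ns with hTs
  set L := allMovesZ D Bkey Ts Hs M with hL
  set LA := allAdj D Bkey Ts Hs M with hLA
  -- every accepted move is licensed
  have hLok : ∀ n, ∀ mv ∈ allMovesZ D Bkey Ts Hs n, D.ok mv.1 mv.2.1 = true := by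
    intro n
    induction n with
    | zero => intro mv hmv; rw [allMovesZ_zero] at hmv; exact absurd hmv List.not_mem_nil
    | succ n ih =>
      intro mv hmv
      rw [allMovesZ_succ, List.mem_append] at hmv
      rcases hmv with hmv | hmv
      · exact ih mv hmv
      · rw [movesOfZ, quotMovesZ, List.mem_filterMap] at hmv
        obtain ⟨a, ha, hmap⟩ := hmv
        obtain ⟨e, hae, hFe⟩ := Option.map_eq_some_iff.1 hmap
        obtain ⟨hok, -, -⟩ := annotate_ok D Bkey _ _ a ha e hae
        rw [← hFe]
        exact hok
  let γf : Fin L.length → DihedralGroup 4 := fun l => d4OfCode (L.get l).1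
  let wvf : Fin L.length → Site 2 := fun l => siteOfPair (L.get l).2.1
  let gf : Fin L.length → Orb (Fin Nβ) → Orb (Fin N) := fun l => gq D (γf l) (wvf l)
  let SYf : Fin L.length → Terms (Orb (Fin Nβ)) := fun l => (L.get l).2.2
  have hγS : ∀ l, γf l ∈ S := fun l => hokS _ _ (hLok M _ (List.get_mem L l))
  have hsh : ∀ l, d4ShiftSet (γf l) (wvf l) Λ ⊆ Λ' := fun l =>
    shiftSet_subset_of_table D hxs hcovβ (γf l) (wvf l) (hokV _ _ (hLok M _ (List.get_mem L l)))
  have hg : ∀ l b, d (gf l b) = Orb.embMap (PolySite.incl (hsh l)) (Orb.embMap (PolySite.d4Emb (γf l) (wvf l) Λ) (dΛ b)) :=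
    fun l b => by rw [← orb_ofLex_eq b]; exact d_gq D hxs d hdx hix hxsβ dΛ hdΛ (γf l) (wvf l) (hsh l) _ _
  -- the semantic residual hypothesis WITH the accepted family
  have hRsem : evalPoly d (SOSDual.decPoly N (Cs.getD M [])) =
      termOp d (residTG TX μ ν o κhi hi κlo lo TE TGs.flatten TH D.f EB gf SYf CW (AV ++ LA)) := by
    rw [evalPoly_chainQA_nil hd hC0 hchain, hTs, flatten_groupSlices,
      termOp_flatten_residTGslicesNear hd TX μ ν o κhi hi κlo lo TE _ TH D.f EB masks _ _ CW AV hfar,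
      termOp_residTG_moves_adj d TX μ ν o κhi hi κlo lo TE _ TH D.f EB gf SYf CW AV LA, ← hL, ← hLA, termOp_symTL_eq]
  exact affineOrbitLowerRowN_of_residPolyG tp U hU hΛ h8 h0 hz h1 hmul d dΛ D.f hf sp hsp TH hH TE hE o ho TX μ ν κhi hi κlo lo
    TGs.flatten hΛm O hTG EB γf hγS wvf hsh gf hg SYf CW hcw (AV ++ LA) hRsem hs hq


/-- **THE CLOSER OF RECORD, TWO-LEVEL GRAM** (`TGs := gramTBslices K blocks`, PSD by construction, no positivity obligation): hinted-quotient +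
adjoint `stepEQA` chain over the residual with EOM-NEAR slices, table facts, ONE inequality ⇒
`SquareTTPrimeCorrAffineOrbitLowerRowN tp U q hi lo κhi κlo s n₀ S Λ' (termOp d TX)`. [cite: WangEtAl2024, §III] [cite: Han2020Bootstrap, §3]
[cite: JanssonChaykinKeil2008, §3] -/
theorem affineOrbitLowerRowN_of_quotAdjChainKernelCertTBNear
    (tp U : ℚ) (hU : 0 ≤ U)
    {Λ Λ' : Finset (Site 2)} (hΛ : Λ ⊆ Λ') (h8 : thicken Λ 1 ⊆ Λ')
    (h0 : thicken ({0} : Finset (Site 2)) 1 ⊆ Λ') (hz : (0 : Site 2) ∈ Λ')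
    {S : Finset (DihedralGroup 4)} (h1 : (1 : DihedralGroup 4) ∈ S) (hmul : ∀ a ∈ S, ∀ b ∈ S, a * b ∈ S)
    (D : QuotData N Nβ) (hxs : ∀ i, D.xs i ∈ Λ') (hix : ∀ y ∈ Λ', D.xs (D.ix y) = y)
    (hxsβ : ∀ j, D.xsβ j ∈ Λ) (hcovβ : ∀ x ∈ Λ, ∃ j, D.xsβ j = x)
    (d : Orb (Fin N) → Orb (PolySite Λ')) (hd : Function.Injective d)
    (hdx : ∀ i σ, d (orb i σ) = orb (PolySite.pt (D.xs i) (hxs i)) σ) (Bkey : ℕ)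
    (dΛ : Orb (Fin Nβ) → Orb (PolySite Λ)) (hdΛ : ∀ j σ, dΛ (orb j σ) = orb (PolySite.pt (D.xsβ j) (hxsβ j)) σ)
    (hf : ∀ b, d (D.f b) = Orb.embMap (PolySite.incl hΛ) (dΛ b))
    (sp : Orb (Fin N) → Fin 2) (hsp : ∀ a, (ofLex (d a)).2 = sp a)
    (hokS : ∀ γc v, D.ok γc v = true → d4OfCode γc ∈ S)
    (hokV : ∀ γc v, D.ok γc v = true →
      ∀ j : Fin Nβ, D.xs (D.ix (d4Vec (d4OfCode γc) (D.xsβ j) + siteOfPair v)) = d4Vec (d4OfCode γc) (D.xsβ j) + siteOfPair v)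
    (TH : Terms (Orb (Fin N))) (hH : termOp d TH = (hubbardTTPrimeFermionInteraction 1 tp U).localHamiltonian Λ')
    (TE : Terms (Orb (Fin N)))
    (hE : termOp d TE = fermionEmbed (PolySite.incl h0) ((hubbardTTPrimeFermionInteraction 1 tp U).meanEnergyObs 1))
    (o : Fin 2 → Orb (Fin N)) (ho : ∀ σ, d (o σ) = orb (PolySite.pt 0 hz) σ)
    (TX : Terms (Orb (Fin N))) (μ : Fin 2 → ℚ) (ν κhi hi κlo lo : ℚ) (K : ℕ)
    (blocks : List (List (List ℤ × Terms (Orb (Fin N))))) (EB : List (Terms (Orb (Fin Nβ))))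
    (masks : List (List Bool)) (hfar : eomFarOK TH D.f EB masks = true)
    (CW : Terms (Orb (Fin N))) (hcw : ∀ wc ∈ CW, chargeW wc.1 ≠ 0 ∨ spinChargeW sp wc.1 ≠ 0)
    (AV : List (Terms (Orb (Fin N))))
    (ns : List ℕ) (M : ℕ) (Cs : List SOSDual.EncPoly) (hC0 : Cs.getD 0 [] = []) (Hs : List (List (QHint Nβ)))
    (hchain : ChainQAOK D Bkey M Cs
      (groupSlices (residTGslicesNear TX μ ν o κhi hi κlo lo TE (gramTBslices K blocks) TH D.f EB masks
        (fun l : Fin 0 => l.elim0) (fun l : Fin 0 => l.elim0) CW AV) ns) Hs)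
    {q s n₀ : ℚ} (hs : s = (μ 0 + μ 1) / 2)
    (hq : q ≤ lowerConst (SOSDual.decPoly N (Cs.getD M [])) + (μ 0 + μ 1) * (n₀ / 2 - ν)) :
    SquareTTPrimeCorrAffineOrbitLowerRowN (tp : ℝ) (U : ℝ) q hi lo κhi κlo s n₀ S Λ' (termOp d TX) := by
  have hTG : termOp d (gramTBslices K blocks).flatten = gramForm (gramTBCoef K blocks) (gramTBOp d blocks) := by
    rw [flatten_gramTBslices, termOp_gramTB_eq_gramForm]
  exact affineOrbitLowerRowN_of_quotAdjChainKernelCertGNear tp U hU hΛ h8 h0 hz h1 hmul D hxs hix hxsβ hcovβ d hd hdx Bkey dΛ hdΛ hf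
    sp hsp hokS hokV TH hH TE hE o ho TX μ ν κhi hi κlo lo (gramTBslices K blocks) (gramTBCoef_posSemidef K blocks) (gramTBOp d blocks)
    hTG EB masks hfar CW hcw AV ns M Cs hC0 Hs hchain hs hq

end QuotAdjNearCloser

end CARPolyWindow

end Summit.Ventures.CertifiedManyBodySolver
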